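import Mathlib
import HarnessLib

/-!
# `DensityLadder.SeparatedTowerDensityLine` (item stmt-RiemannHypothesis-24918) — the pointwise
# window bound (BC5 rung P2 of LINE L57)

LINE L57 «sieve sight above the density line» (rh-idea-10 g1), crux K1 `SeparatedTowerDensityLine`
(stmt-RiemannHypothesis-24918), stub S1 of the registered skeleton `Birth.lean`, step (a) of the
mean-value argument ("pointwise window bound |E(x)| ≤ C η x log x from integrality + log bound, no
sieve theorem needed").  For an INTEGER-supported weight `0 ≤ w(n) ≤ B log(n+2)` and a bounded bump
`φ` vanishing off `(−1, 1)`, the window sum `P = Σ_n w(n) φ((n/x − 1)/η)` runs over the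
`≤ 2ηx + 1` integers of `(x(1−η), x(1+η))`, so `0 ≤ P ≤ 2|B| M (2ηx + 1) log x` for `x ≥ 3`
(`window_primeSum_le`); fed into the explicit-formula hypothesis of K1 this bounds the real part
of the zero sum: `|Re S_η(x)| ≤ C (x log x + (log x)/η)` (`pointwise_zeroSum_re_bound`).
Cell rh-split, seat rh-split-prover-l57 g0.  RH-free, ζ-free; FRONTIER bookkeeping; nothing here
bears on the truth of RH.
-/

set_option linter.dupNamespace false

noncomputable section

open Complex Filter Set MeasureTheory Topology
open scoped Real

namespace Summit.RiemannHypothesis.RiemannHypothesis.Theorems.DensityLadderSeparatedTowerPointwise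

/-- The integers of the window `(x(1−η), x(1+η))` inside any finite set number at most `2ηx + 1`.
[folklore] -/
theorem card_filter_window_le (s : Finset ℕ) {η x : ℝ} (hη : 0 < η) (hx : 0 < x) :
    ((s.filter fun n : ℕ ↦ x * (1 - η) < n ∧ (n : ℝ) < x * (1 + η)).card : ℝ) ≤ 2 * η * x + 1 := by
  classical
  set a : ℕ := ⌈x * (1 - η)⌉₊ with ha
  set b : ℕ := ⌊x * (1 + η)⌋₊ with hb
  have hsub : (s.filter fun n : ℕ ↦ x * (1 - η) < n ∧ (n : ℝ) < x * (1 + η)) ⊆ Finset.Icc a b := by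
    intro n hn
    rw [Finset.mem_filter] at hn
    rw [Finset.mem_Icc]
    refine ⟨?_, ?_⟩
    · exact Nat.ceil_le.2 hn.2.1.le
    · exact Nat.le_floor hn.2.2.le
  have hcard := Finset.card_le_card hsub
  rw [Nat.card_Icc] at hcard
  have hb' : (b : ℝ) ≤ x * (1 + η) := Nat.floor_le (by nlinarith)
  have ha' : x * (1 - η) ≤ a := Nat.le_ceil _
  have hpos : 0 ≤ 2 * η * x + 1 := by positivity
  rcases le_or_gt a (b + 1) with h | h
  · calc ((s.filter fun n : ℕ ↦ x * (1 - η) < n ∧ (n : ℝ) < x * (1 + η)).card : ℝ)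
        ≤ ((b + 1 - a : ℕ) : ℝ) := by exact_mod_cast hcard
      _ = (b : ℝ) + 1 - a := by rw [Nat.cast_sub h]; push_cast; ring
      _ ≤ 2 * η * x + 1 := by linarith
  · have h0 : b + 1 - a = 0 := Nat.sub_eq_zero_of_le h.le
    rw [h0, Nat.le_zero] at hcard
    rw [hcard, Nat.cast_zero]
    exact hpos

/-- **The prime-side window sum is trivially bounded** (integrality + `0 ≤ w ≤ B log`):
`0 ≤ Σ_n w(n) φ((n/x−1)/η) ≤ 2 |B| M (2ηx + 1) log x` for `|φ| ≤ M` vanishing off `(−1,1)`,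
`0 < η ≤ 1/2`, `x ≥ 3`. [folklore] -/
theorem window_primeSum_le (w : ℕ → ℝ) {B : ℝ} (hw : ∀ n : ℕ, 0 ≤ w n ∧ w n ≤ B * Real.log ((n : ℝ) + 2))
    (φ : ℝ → ℝ) {M : ℝ} (hM : ∀ v, |φ v| ≤ M) (hφs : ∀ v, 1 ≤ |v| → φ v = 0)
    {η x : ℝ} (hη : 0 < η) (hη1 : η ≤ 1 / 2) (hx : 3 ≤ x) :
    |∑' n : ℕ, w n * φ (((n : ℝ) / x - 1) / η)| ≤ 2 * |B| * M * (2 * η * x + 1) * Real.log x := by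
  classical
  have hx0 : 0 < x := by linarith
  have hM0 : 0 ≤ M := (abs_nonneg _).trans (hM 0)
  have hlogx : 1 ≤ Real.log x := by
    rw [← Real.log_exp 1]
    exact Real.log_le_log (Real.exp_pos 1) (by have := Real.exp_one_lt_d9; linarith)
  -- each term: `0 ≤ w n φ_n`?  No: `φ` may change sign; bound `|w n φ_n|` instead.
  set f : ℕ → ℝ := fun n ↦ w n * φ (((n : ℝ) / x - 1) / η) with hf
  -- termwise bound by the window indicator
  have hterm : ∀ n : ℕ, |f n| ≤
      if x * (1 - η) < n ∧ (n : ℝ) < x * (1 + η) then 2 * |B| * M * Real.log x else 0 := by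
    intro n
    by_cases hn : x * (1 - η) < n ∧ (n : ℝ) < x * (1 + η)
    · rw [if_pos hn, hf]
      simp only
      rw [abs_mul, abs_of_nonneg (hw n).1]
      have hlogn : Real.log ((n : ℝ) + 2) ≤ 2 * Real.log x := by
        have h15 : (n : ℝ) ≤ 3 / 2 * x := by nlinarith [hn.2]
        calc Real.log ((n : ℝ) + 2) ≤ Real.log (x ^ 2) :=
              Real.log_le_log (by positivity) (by nlinarith)
          _ = 2 * Real.log x := by rw [Real.log_pow]; norm_num
      have hwn : w n ≤ |B| * (2 * Real.log x) :=
        (hw n).2.trans ((mul_le_mul_of_nonneg_right (le_abs_self B)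
          (Real.log_nonneg (by have := (Nat.cast_nonneg n : (0:ℝ) ≤ n); linarith))).trans
          (mul_le_mul_of_nonneg_left hlogn (abs_nonneg B)))
      calc w n * |φ (((n : ℝ) / x - 1) / η)| ≤ (|B| * (2 * Real.log x)) * M :=
            mul_le_mul hwn (hM _) (abs_nonneg _) (by positivity)
        _ = 2 * |B| * M * Real.log x := by ring
    · rw [if_neg hn, hf]
      simp only
      have hφ0 : φ (((n : ℝ) / x - 1) / η) = 0 := by
        apply hφs
        rw [not_and_or, not_lt, not_lt] at hn
        rw [abs_div, abs_of_pos hη, le_div_iff₀ hη, one_mul]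
        rcases hn with h | h
        · have : (n : ℝ) / x - 1 ≤ -η := by
            rw [div_sub_one hx0.ne', div_le_iff₀ hx0]; linarith
          calc η = |(-η)| := by rw [abs_neg, abs_of_pos hη]
            _ ≤ |(n : ℝ) / x - 1| := by
                rw [abs_neg, abs_of_pos hη, abs_of_nonpos (by linarith)]; linarith
        · have : η ≤ (n : ℝ) / x - 1 := by
            rw [div_sub_one hx0.ne', le_div_iff₀ hx0]; linarith
          exact this.trans (le_abs_self _)
      rw [hφ0, mul_zero, abs_zero]
  -- sum of the majorant over any finite set
  have hmaj : ∀ u : Finset ℕ, ∑ n ∈ u, |f n| ≤ 2 * |B| * M * (2 * η * x + 1) * Real.log x := by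
    intro u
    calc ∑ n ∈ u, |f n|
        ≤ ∑ n ∈ u, (if x * (1 - η) < n ∧ (n : ℝ) < x * (1 + η) then 2 * |B| * M * Real.log x else 0) :=
          Finset.sum_le_sum fun n _ ↦ hterm n
      _ = ((u.filter fun n : ℕ ↦ x * (1 - η) < n ∧ (n : ℝ) < x * (1 + η)).card : ℝ) *
            (2 * |B| * M * Real.log x) := by
          rw [Finset.sum_ite, Finset.sum_const_zero, add_zero, Finset.sum_const, nsmul_eq_mul]
      _ ≤ (2 * η * x + 1) * (2 * |B| * M * Real.log x) :=
          mul_le_mul_of_nonneg_right (card_filter_window_le u hη hx0) (by positivity)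
      _ = 2 * |B| * M * (2 * η * x + 1) * Real.log x := by ring
  have habs : ∑' n : ℕ, |f n| ≤ 2 * |B| * M * (2 * η * x + 1) * Real.log x :=
    Real.tsum_le_of_sum_le (fun n ↦ abs_nonneg _) hmaj
  have hsum : Summable fun n ↦ |f n| := summable_of_sum_le (fun n ↦ abs_nonneg _) hmaj
  calc |∑' n : ℕ, f n| = ‖∑' n : ℕ, f n‖ := (Real.norm_eq_abs _).symm
    _ ≤ ∑' n : ℕ, ‖f n‖ := norm_tsum_le_tsum_norm (by simpa [Real.norm_eq_abs] using hsum)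
    _ = ∑' n : ℕ, |f n| := by simp [Real.norm_eq_abs]
    _ ≤ _ := habs

/-- **Pointwise bound for the real part of the zero sum** (step (a) of stub S1 of crux
`SeparatedTowerDensityLine`): if the explicit-formula hypothesis of K1 holds for the bump `φ`
(`|φ| ≤ M`, vanishing off `(−1,1)`) with constant `C_φ`, and `0 ≤ w ≤ B log(·+2)`, then for
`0 < η ≤ 1/2`, `x ≥ 3`,
`|Re Σ'_i m_i x^{ρ_i} ∫φ(v)(1+ηv)^{ρ_i−1}dv| ≤ (C_φ + 2M + 6|B|M)(x log x + (log x)/η)`. [folklore] -/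
theorem pointwise_zeroSum_re_bound {ι : Type} (m : ι → ℝ) (ρ : ι → ℂ) (w : ℕ → ℝ) {B : ℝ}
    (hw : ∀ n : ℕ, 0 ≤ w n ∧ w n ≤ B * Real.log ((n : ℝ) + 2))
    (φ : ℝ → ℝ) {M : ℝ} (hM : ∀ v, |φ v| ≤ M) (hφs : ∀ v, 1 ≤ |v| → φ v = 0) {Cφ : ℝ}
    (hEF : ∀ η x : ℝ, 0 < η → η ≤ 1 / 2 → 3 ≤ x →
      |(∑' n : ℕ, w n * φ (((n : ℝ) / x - 1) / η)) - η * x * (∫ v in (-1 : ℝ)..1, φ v) +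
        η * (∑' i : ι, (m i : ℂ) * ((x : ℂ) ^ (ρ i) *
          ∫ v in (-1 : ℝ)..1, (φ v : ℂ) * ((1 : ℂ) + (η : ℂ) * (v : ℂ)) ^ (ρ i - 1))).re| ≤
        Cφ * Real.log x)
    {η x : ℝ} (hη : 0 < η) (hη1 : η ≤ 1 / 2) (hx : 3 ≤ x) :
    |(∑' i : ι, (m i : ℂ) * ((x : ℂ) ^ (ρ i) *
        ∫ v in (-1 : ℝ)..1, (φ v : ℂ) * ((1 : ℂ) + (η : ℂ) * (v : ℂ)) ^ (ρ i - 1))).re| ≤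
      (Cφ + 2 * M + 6 * |B| * M) * (x * Real.log x + Real.log x / η) := by
  have hx0 : 0 < x := by linarith
  have hM0 : 0 ≤ M := (abs_nonneg _).trans (hM 0)
  have hlogx : 1 ≤ Real.log x := by
    rw [← Real.log_exp 1]
    exact Real.log_le_log (Real.exp_pos 1) (by have := Real.exp_one_lt_d9; linarith)
  set S : ℝ := (∑' i : ι, (m i : ℂ) * ((x : ℂ) ^ (ρ i) *
    ∫ v in (-1 : ℝ)..1, (φ v : ℂ) * ((1 : ℂ) + (η : ℂ) * (v : ℂ)) ^ (ρ i - 1))).re with hS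
  have h1 := hEF η x hη hη1 hx
  have hP := window_primeSum_le w hw φ hM hφs hη hη1 hx
  have hI : |∫ v in (-1 : ℝ)..1, φ v| ≤ M * |1 - (-1)| :=
    intervalIntegral.norm_integral_le_of_norm_le_const fun v _ ↦ (Real.norm_eq_abs _).le.trans (hM v)
  rw [show |(1 : ℝ) - (-1)| = 2 by norm_num] at hI
  -- `η |S| ≤ Cφ log x + |P| + η x |∫φ|`
  have hηS : η * |S| ≤ Cφ * Real.log x + 2 * |B| * M * (2 * η * x + 1) * Real.log x +
      η * x * (2 * M) := by
    have e : η * S = ((∑' n : ℕ, w n * φ (((n : ℝ) / x - 1) / η)) - η * x * (∫ v in (-1 : ℝ)..1, φ v)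
        + η * S) - (∑' n : ℕ, w n * φ (((n : ℝ) / x - 1) / η)) + η * x * (∫ v in (-1 : ℝ)..1, φ v) := by
      ring
    rw [← abs_of_pos hη, ← abs_mul, e]
    refine (abs_add_le _ _).trans ?_
    refine (add_le_add (abs_sub _ _) le_rfl).trans ?_
    rw [abs_mul, abs_mul, abs_of_pos hη, abs_of_pos hx0]
    have := mul_le_mul_of_nonneg_left hI (by positivity : 0 ≤ η * x)
    linarith
  -- divide by `η` and absorb
  have hηpos := hη
  have key : |S| ≤ (Cφ * Real.log x + 2 * |B| * M * (2 * η * x + 1) * Real.log x +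
      η * x * (2 * M)) / η := by
    rw [le_div_iff₀ hη]; linarith
  refine key.trans ?_
  rw [div_le_iff₀ hη]
  have hB0 : 0 ≤ |B| := abs_nonneg B
  -- `x ≤ x log x`, `log x ≥ 1`
  have hxlx : x ≤ x * Real.log x := le_mul_of_one_le_right hx0.le hlogx
  have e1 : (Cφ + 2 * M + 6 * |B| * M) * (x * Real.log x + Real.log x / η) * η =
      (Cφ + 2 * M + 6 * |B| * M) * (η * (x * Real.log x) + Real.log x) := by
    field_simp
  rw [e1]
  have hC0 : 0 ≤ Cφ := by
    by_contra hneg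
    have : Cφ * Real.log x < 0 := mul_neg_of_neg_of_pos (not_le.1 hneg) (by linarith)
    linarith [abs_nonneg ((∑' n : ℕ, w n * φ (((n : ℝ) / x - 1) / η)) -
      η * x * (∫ v in (-1 : ℝ)..1, φ v) + η * S)]
  have hL0 : 0 ≤ Real.log x := by linarith
  have p1 : 0 ≤ Cφ * η * x * Real.log x := by positivity
  have p2 : 0 ≤ M * η * x * (Real.log x - 1) :=
    mul_nonneg (by positivity) (sub_nonneg.2 hlogx)
  have p3 : 0 ≤ M * Real.log x := by positivity
  have p4 : 0 ≤ |B| * M * η * x * Real.log x := by positivity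
  have p5 : 0 ≤ |B| * M * Real.log x := by positivity
  nlinarith [p1, p2, p3, p4, p5]

end Summit.RiemannHypothesis.RiemannHypothesis.Theorems.DensityLadderSeparatedTowerPointwise

end
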